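import Literature.NumberTheory.Sieve.MatomakiRadziwillLemma14
import HarnessLib

/-!
# The Parseval bound for short sums with complex coefficients (Matomäki–Radziwiłł–Tao 2015, App. A)

Topic `Literature/NumberTheory/LFunctions`.  Everything in this file is PROVED.

K. Matomäki, M. Radziwiłł, T. Tao, *An averaged form of Chowla's conjecture*, Algebra & Number Theory
**9** (2015), Appendix A, begin the proof of Theorem A.2 (the complex Matomäki–Radziwiłł theorem; the
named fact `Literature.NumberTheory.LFunctions.MatomakiRadziwillTao2015_theoremA2` of the tree) with
"a Parseval bound
`(1/X) ∫_X^{2X} |h⁻¹ ∑_{x ≤ n ≤ x+h, n ∈ 𝒮} f(n)|² dx ≪ ∫_1^{1+iX/h} |F(s)|² |ds| + max_{T ≥ X/h} (X/h)/T ∫_{1+iT}^{1+2iT} |F(s)|² |ds|`.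
This follows exactly in the same way as [MR 2016, Lemma 14] but there is no need to split the integral
into two parts, and one can just work as for `V(x)` there."  For COMPLEX coefficients the printed
one-sided right-hand side (frequencies `t ≥ 0` only) does not control the left-hand side (the symmetry
`|F(1-it)| = |F(1+it)|` holds only for real coefficients — see the discussion of
`Literature.NumberTheory.Sieve.MatomakiRadziwill2016_lemma14_real` in `Sieve/MatomakiRadziwill.lean`);
this file proves the bound in the two-sided form that the mechanism actually gives, for an arbitrary
complex sequence `|a_m| ≤ 1`:

* `Literature.NumberTheory.LFunctions.MRT2015.Parseval.meanSquare_shortAvg_le` — there is an absolute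
  `C` (`= 520 π e⁴`) such that for `X ≥ 1`, `1 ≤ h ≤ X`,
  `(1/X) ∫_X^{2X} |h⁻¹ ∑_{x ≤ m ≤ x+h, X ≤ m ≤ 2X} a_m|² dx
     ≤ C (∫_0^{X/h} B(t) dt + sup_{T ≥ X/h} (X/h)/T ∫_T^{2T} B(t) dt)`,
  `B(t) = |A(1+it)|² + |A(1-it)|²`, `A(s) = ∑_{X ≤ m ≤ 2X} a_m m^{-s}` (`Apoly`, `Bsq`, `Ssup`).

The consumer is the deduction of Theorem A.2 from Proposition A.3 (Matomäki–Radziwiłł–Tao, App. A),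
where `a_m = f(m) 1_𝒮(m)`.

## The argument

We follow the Plancherel route of the tree's proof of MR Lemma 14 (`Sieve/MatomakiRadziwillLemma14.lean`,
`LFunctions/DirichletPolynomialShortWindows.lean`) with two changes: the coefficients are complex, and the
windows carry the exact weight `m/y`, which removes the "Step A" error `O(h/X)` of that proof (fatal here,
where `h` may be as large as `X`) and makes a low/high frequency split unnecessary.

1. *Weighted log-windows.* `G_θ(v) = ∑ b_m e^{log m - v} 1[log m - θ ≤ v < log m]` (`wlogWindow`), with
   `b_m = a_m/m` on `[X, 2X]`; at `v = log y` this is `y⁻¹ ∑_{y < m ≤ y e^θ} a_m`.  Its Fourier transform is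
   `κ_θ(ξ) A(ξ)` with `κ_θ(ξ) = ∫_0^θ e^u e(ξu) du` (`fourier_wlogWindow`), and
   `|κ_θ(ξ)|² ≤ e⁴ min(Θ², 1/ξ²)` for `0 ≤ θ ≤ Θ ≤ 2`, `ξ ≠ 0` (`norm_sq_wTransform_le`), whence by Plancherel
   on `L¹ ∩ L²` (`Literature.Analysis.FunctionSpaces.integral_norm_sq_fourierIntegral_eq`)
   `∫ |G_θ|² ≤ e⁴ ∫_ℝ min(Θ², 1/ξ²) |A(ξ)|² dξ` (`integral_norm_sq_wlogWindow_le`) — a TWO-SIDED frequency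
   integral.
2. *Exact window identity* (Saffari–Vaughan form): for `θ ∈ [θ_a, θ_b]` (`θ_a = log(1+h/X)`,
   `θ_b = θ_a + h/X`, from the Lemma 14 file) and `c = log(1 + h/y)`,
   `∑_{y < m ≤ y+h} a_m = y G_θ(log y) - (y+h) G_{θ-c}(log(y+h))` (`sum_window_eq`), so that
   `|h⁻¹ ∑|² ≤ 13 (X/h)² (|G_θ(log y)|² + |G_{θ-c}(log(y+h))|²)` (`norm_sq_shortAvg_le_pointwise`).
3. *Averaging over `θ`, Tonelli, `y = e^v`* (`norm_sq_shortAvg_le_Qint`, `setIntegral_Qint_log_le`,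
   `setIntegral_norm_sq_shortAvg_le`): `∫_{(X,2X]} |h⁻¹∑|² ≤ 130 e⁴ (X³/h²) P(θ_b)`,
   `P(Θ) = ∫ min(Θ², 1/ξ²)|A(ξ)|² dξ`.
4. *Frequency side* (`Pfreq_le`): substitute `t = 2πξ`, fold `t ↦ -t` onto `t > 0` (`B(t)`), use
   `min ≤ θ_b² ≤ 4(h/X)²` on `t ≤ X/h` and `min ≤ 4π²/t²` with a dyadic decomposition against the `sup`
   term on `t > X/h` (`integral_Ioi_le_Ssup`): `P ≤ 4π (h/X)² (I + S)`.

## References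

* K. Matomäki, M. Radziwiłł, T. Tao, *An averaged form of Chowla's conjecture*, Algebra & Number Theory 9
  (2015), 2167–2196 (arXiv:1503.05121), Appendix A, the display following Theorem A.2 ("Parseval
  bound"). [cite: MatomakiRadziwillTao2015, Appendix A]
* K. Matomäki, M. Radziwiłł, *Multiplicative functions in short intervals*, Ann. of Math. 183 (2016),
  §7, Lemma 14 and its proof (the mechanism).

## Relation to the other Parseval files of the tree (what is NOT here)

`Sieve/MatomakiRadziwillLemma14.lean` (MR Lemma 14, real sequences) and
`Sieve/MoebiusShiftedPrimesParseval.lean` (`Lichtman2020.parseval_bound_complex`: complex sequences by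
splitting into real and imaginary parts) bound the DIFFERENCE `S_{h₁}/h₁ - S_{h₂}/h₂` of two short
averages with a low/high frequency cutoff `T₀`, an error term `1/T₀²`, and `h₂ ≤ X/T₀³`.  Theorem A.2 has
a single window of any length `Q₁ ≤ h` (up to and beyond `X`) and no auxiliary long window, so neither
statement applies; this file proves the single-window bound without cutoff and without error term, which
is what the deduction "Proposition A.3 ⟹ Theorem A.2" consumes.  The dyadic/`sup` bookkeeping and the
change of variables are borrowed from the Lemma 14 file (`MatomakiRadziwillL14.*`).

## Design choices

* Integers of a real window `[x, x+h]` are `Finset.Icc ⌈x⌉₊ ⌊x+h⌋₊` (as in the vendored Theorem A.2);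
  the restriction `X ≤ m ≤ 2X` is a `Finset.filter`, so that the statement applies verbatim to
  `a_m = f(m) 1_𝒮(m)` and the polynomial `∑_{X ≤ m ≤ 2X} a_m m^{-1-it}` is literally the `F(1+it)` of
  Proposition A.3.
* `1 ≤ h ≤ X` (then all windows lie in `[X, 3X]`, `θ_b ≤ 2`, `X/h ≥ 1`); larger `h` are reduced to
  `h = X` by the consumer.
* The `sup` is an `iSup` over the subtype `T ∈ Set.Ici (X/h)` of a family bounded by `8 X/h`
  (`bddAbove_Ssup`), hence a genuine supremum.
-/

noncomputable section

open MeasureTheory Real Complex Finset Set Filter FourierTransform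

namespace Literature.NumberTheory.LFunctions

namespace MRT2015.Parseval

/-! ### Weighted logarithmic windows -/

/-- The **weighted window sum in logarithmic scale**
`G_θ(v) = ∑_{m ∈ s} b_m e^{log m - v} 1[log m - θ ≤ v < log m]`, i.e. `∑ b_m (m/y)` over
`y < m ≤ y e^θ` at `y = e^v`.  With `b_m = a_m/m` this is `y⁻¹ ∑_{y < m ≤ y e^θ} a_m` exactly. [folklore] -/
def wlogWindow (s : Finset ℕ) (b : ℕ → ℂ) (θ v : ℝ) : ℂ :=
  ∑ m ∈ s, b m * (Real.exp (Real.log m - v) : ℂ) * (Set.Ico (Real.log m - θ) (Real.log m)).indicator 1 v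

/-- The Fourier multiplier of the weighted window: `κ_θ(ξ) = ∫_0^θ e^u e(ξ u) du`. [folklore] -/
def wTransform (θ ξ : ℝ) : ℂ :=
  ∫ u in (0 : ℝ)..θ, Complex.exp ((1 + 2 * π * ξ * Complex.I) * u)

/-- The Dirichlet polynomial in Fourier normalisation with complex coefficients,
`A(ξ) = ∑_{m ∈ s} b_m e(-ξ log m)` (`= ∑ b_m m^{-it}` at `t = 2πξ`). [folklore] -/
def dirichletSumC (s : Finset ℕ) (b : ℕ → ℂ) (ξ : ℝ) : ℂ :=
  ∑ m ∈ s, b m * Complex.exp (↑(-2 * π * (ξ * Real.log m)) * Complex.I)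

/-- `G_θ(v)` is the weighted sum over the `m ∈ s` with `log m - θ ≤ v < log m`. [folklore] -/
theorem wlogWindow_apply (s : Finset ℕ) (b : ℕ → ℂ) (θ v : ℝ) :
    wlogWindow s b θ v = ∑ m ∈ s.filter (fun m : ℕ => Real.log m - θ ≤ v ∧ v < Real.log m),
      b m * (Real.exp (Real.log m - v) : ℂ) := by
  rw [wlogWindow, Finset.sum_filter]
  refine Finset.sum_congr rfl fun m _ => ?_
  by_cases h : Real.log (m : ℝ) - θ ≤ v ∧ v < Real.log m
  · rw [if_pos h, Set.indicator_of_mem (by exact h), Pi.one_apply, mul_one]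
  · rw [if_neg h, Set.indicator_of_notMem (by exact h), mul_zero]

/-- `‖G_θ(v)‖ ≤ e^θ ∑ ‖b_m‖`. [folklore] -/
theorem norm_wlogWindow_le (s : Finset ℕ) (b : ℕ → ℂ) (θ v : ℝ) :
    ‖wlogWindow s b θ v‖ ≤ Real.exp θ * ∑ m ∈ s, ‖b m‖ := by
  unfold wlogWindow
  rw [Finset.mul_sum]
  refine (norm_sum_le _ _).trans (Finset.sum_le_sum fun m _ => ?_)
  by_cases h : v ∈ Set.Ico (Real.log m - θ) (Real.log m)
  · rw [Set.indicator_of_mem h, Pi.one_apply, mul_one, norm_mul, Complex.norm_real, Real.norm_eq_abs,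
      abs_of_pos (Real.exp_pos _), mul_comm]
    refine mul_le_mul_of_nonneg_right (Real.exp_le_exp.2 ?_) (norm_nonneg _)
    have := h.1; linarith
  · rw [Set.indicator_of_notMem h, mul_zero, norm_zero]
    exact mul_nonneg (Real.exp_pos θ).le (norm_nonneg _)

/-- One weighted window piece `v ↦ e^{c - v} 1_{[c-θ, c)}(v)` as an indicator. [folklore] -/
theorem wpiece_eq_indicator (c θ v : ℝ) :
    (Real.exp (c - v) : ℂ) * (Set.Ico (c - θ) c).indicator (1 : ℝ → ℂ) v
      = (Set.Ico (c - θ) c).indicator (fun v : ℝ => (Real.exp (c - v) : ℂ)) v := by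
  by_cases h : v ∈ Set.Ico (c - θ) c
  · simp [Set.indicator_of_mem h]
  · simp [Set.indicator_of_notMem h]

/-- The weighted window piece is integrable. [folklore] -/
theorem integrable_wpiece (c θ : ℝ) :
    Integrable (fun v : ℝ => (Real.exp (c - v) : ℂ) * (Set.Ico (c - θ) c).indicator (1 : ℝ → ℂ) v) := by
  simp_rw [wpiece_eq_indicator]
  refine (integrable_indicator_iff measurableSet_Ico).2 ?_
  have hc : Continuous fun v : ℝ => (Real.exp (c - v) : ℂ) := by fun_prop
  exact (hc.integrableOn_Icc (a := c - θ) (b := c)).mono_set Set.Ico_subset_Icc_self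

/-- `G_θ` is integrable. [folklore] -/
theorem integrable_wlogWindow (s : Finset ℕ) (b : ℕ → ℂ) (θ : ℝ) : Integrable (wlogWindow s b θ) := by
  unfold wlogWindow
  refine integrable_finsetSum _ fun m _ => ?_
  simp_rw [mul_assoc]
  exact (integrable_wpiece _ _).const_mul _

/-- `G_θ` is measurable. [folklore] -/
theorem measurable_wlogWindow (s : Finset ℕ) (b : ℕ → ℂ) (θ : ℝ) : Measurable (wlogWindow s b θ) := by
  unfold wlogWindow
  refine Finset.measurable_sum _ fun m _ => ?_
  refine (measurable_const.mul ?_).mul (measurable_const.indicator measurableSet_Ico)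
  exact Complex.measurable_ofReal.comp (Real.measurable_exp.comp (measurable_const.sub measurable_id))

/-- `G_θ ∈ L²`. [folklore] -/
theorem memLp_two_wlogWindow (s : Finset ℕ) (b : ℕ → ℂ) (θ : ℝ) :
    MemLp (wlogWindow s b θ) 2 :=
  WindowPlancherel.memLp_two_of_norm_le (integrable_wlogWindow s b θ) (norm_wlogWindow_le s b θ)

/-- Fourier transform of one weighted window piece:
`𝓕[e^{c-v} 1_{[c-θ,c)}](ξ) = e(-ξ c) κ_θ(ξ)`. [folklore] -/
theorem fourier_wpiece (c θ ξ : ℝ) (hθ : 0 ≤ θ) :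
    𝓕 (fun v : ℝ => (Real.exp (c - v) : ℂ) * (Set.Ico (c - θ) c).indicator (1 : ℝ → ℂ) v) ξ
      = Complex.exp (↑(-2 * π * (ξ * c)) * Complex.I) * wTransform θ ξ := by
  rw [Real.fourier_real_eq_integral_exp_smul]
  simp_rw [smul_eq_mul, wpiece_eq_indicator]
  have : ∀ v : ℝ, Complex.exp (↑(-2 * π * v * ξ) * Complex.I)
        * (Set.Ico (c - θ) c).indicator (fun v : ℝ => (Real.exp (c - v) : ℂ)) v
      = (Set.Ico (c - θ) c).indicator
          (fun v => Complex.exp (↑(-2 * π * v * ξ) * Complex.I) * (Real.exp (c - v) : ℂ)) v := by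
    intro v
    by_cases h : v ∈ Set.Ico (c - θ) c
    · simp [Set.indicator_of_mem h]
    · simp [Set.indicator_of_notMem h]
  simp_rw [this]
  rw [MeasureTheory.integral_indicator measurableSet_Ico, MeasureTheory.integral_Ico_eq_integral_Ioc,
    ← intervalIntegral.integral_of_le (by linarith), wTransform]
  -- substitute v = c - u
  have hsub := intervalIntegral.integral_comp_sub_left
    (fun v => Complex.exp (↑(-2 * π * v * ξ) * Complex.I) * (Real.exp (c - v) : ℂ)) c (a := 0) (b := θ)
  rw [sub_zero] at hsub
  rw [← hsub, ← intervalIntegral.integral_const_mul]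
  refine intervalIntegral.integral_congr fun u _ => ?_
  simp only [sub_sub_cancel]
  rw [Complex.ofReal_exp, ← Complex.exp_add, ← Complex.exp_add]
  congr 1
  push_cast
  ring

/-- **Fourier transform of the weighted window sum**: `𝓕 G_θ(ξ) = κ_θ(ξ) · A(ξ)`. [folklore] -/
theorem fourier_wlogWindow (s : Finset ℕ) (b : ℕ → ℂ) {θ : ℝ} (hθ : 0 ≤ θ) (ξ : ℝ) :
    𝓕 (wlogWindow s b θ) ξ = wTransform θ ξ * dirichletSumC s b ξ := by
  have key : 𝓕 (wlogWindow s b θ) ξ = ∑ m ∈ s, b m *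
      𝓕 (fun v : ℝ => (Real.exp (Real.log m - v) : ℂ)
        * (Set.Ico (Real.log m - θ) (Real.log m)).indicator (1 : ℝ → ℂ) v) ξ := by
    simp only [Real.fourier_real_eq_integral_exp_smul, smul_eq_mul]
    calc ∫ v : ℝ, Complex.exp (↑(-2 * π * v * ξ) * Complex.I) * wlogWindow s b θ v
        = ∫ v : ℝ, ∑ m ∈ s, b m * (Complex.exp (↑(-2 * π * v * ξ) * Complex.I)
            * ((Real.exp (Real.log m - v) : ℂ)
              * (Set.Ico (Real.log m - θ) (Real.log m)).indicator (1 : ℝ → ℂ) v)) := by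
          refine integral_congr_ae (Eventually.of_forall fun v => ?_)
          simp only [wlogWindow, Finset.mul_sum]
          exact Finset.sum_congr rfl fun m _ => by ring
      _ = ∑ m ∈ s, ∫ v : ℝ, b m * (Complex.exp (↑(-2 * π * v * ξ) * Complex.I)
            * ((Real.exp (Real.log m - v) : ℂ)
              * (Set.Ico (Real.log m - θ) (Real.log m)).indicator (1 : ℝ → ℂ) v)) := by
          refine integral_finsetSum _ fun m _ => ?_
          exact (WindowPlancherel.integrable_cexp_mul (integrable_wpiece _ _) ξ).const_mul _
      _ = _ := Finset.sum_congr rfl fun m _ => integral_const_mul _ _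
  rw [key, dirichletSumC, Finset.mul_sum]
  refine Finset.sum_congr rfl fun m _ => ?_
  rw [fourier_wpiece _ _ _ hθ]
  ring

/-! ### Bounds for the multiplier `κ_θ` -/

/-- `‖κ_θ(ξ)‖ ≤ θ e^θ` for `θ ≥ 0`. [folklore] -/
theorem norm_wTransform_le (ξ : ℝ) {θ : ℝ} (hθ : 0 ≤ θ) : ‖wTransform θ ξ‖ ≤ θ * Real.exp θ := by
  have key : ‖∫ u in (0 : ℝ)..θ, Complex.exp ((1 + 2 * π * ξ * Complex.I) * u)‖
      ≤ Real.exp θ * |θ - 0| := by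
    refine intervalIntegral.norm_integral_le_of_norm_le_const fun u hu => ?_
    rw [Set.uIoc_of_le hθ] at hu
    rw [Complex.norm_exp]
    refine Real.exp_le_exp.2 (le_of_eq_of_le ?_ hu.2)
    simp [add_mul, Complex.add_re, Complex.mul_re]
  rw [sub_zero, abs_of_nonneg hθ] at key
  unfold wTransform
  linarith [mul_comm θ (Real.exp θ)]

/-- Closed form `κ_θ(ξ) = (e^{θ(1+2πiξ)} - 1)/(1 + 2πiξ)`. [folklore] -/
theorem wTransform_eq (θ ξ : ℝ) :
    wTransform θ ξ = (Complex.exp ((1 + 2 * π * ξ * Complex.I) * θ) - 1) / (1 + 2 * π * ξ * Complex.I) := by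
  unfold wTransform
  have hc : (1 + 2 * π * ξ * Complex.I : ℂ) ≠ 0 := by
    intro h
    have := congrArg Complex.re h
    simp at this
  have := integral_exp_mul_complex (a := 0) (b := θ) hc
  simp only [Complex.ofReal_zero, mul_zero, Complex.exp_zero] at this
  rw [this]

/-- `‖1 + 2πiξ‖ ≥ 2π|ξ|`. [folklore] -/
theorem two_pi_mul_abs_le_norm (ξ : ℝ) : 2 * π * |ξ| ≤ ‖(1 + 2 * π * ξ * Complex.I : ℂ)‖ := by
  have h1 : ((1 + 2 * π * ξ * Complex.I : ℂ)).im = 2 * π * ξ := by simp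
  calc 2 * π * |ξ| = |2 * π * ξ| := by
        rw [abs_mul, abs_of_pos (by positivity : (0:ℝ) < 2 * π)]
    _ = |((1 + 2 * π * ξ * Complex.I : ℂ)).im| := by rw [h1]
    _ ≤ ‖(1 + 2 * π * ξ * Complex.I : ℂ)‖ := Complex.abs_im_le_norm _

/-- `‖κ_θ(ξ)‖ ≤ (e^θ + 1)/(2π|ξ|)` for `ξ ≠ 0`. [folklore] -/
theorem norm_wTransform_le_inv (θ : ℝ) {ξ : ℝ} (hξ : ξ ≠ 0) :
    ‖wTransform θ ξ‖ ≤ (Real.exp θ + 1) / (2 * π * |ξ|) := by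
  rw [wTransform_eq, norm_div]
  have hden : 0 < 2 * π * |ξ| := by positivity
  have h1 : ‖Complex.exp ((1 + 2 * π * ξ * Complex.I) * θ) - 1‖ ≤ Real.exp θ + 1 := by
    refine (norm_sub_le _ _).trans ?_
    rw [Complex.norm_exp, norm_one]
    gcongr
    refine le_of_eq ?_
    simp
  calc ‖Complex.exp ((1 + 2 * π * ξ * Complex.I) * θ) - 1‖ / ‖(1 + 2 * π * ξ * Complex.I : ℂ)‖
      ≤ (Real.exp θ + 1) / ‖(1 + 2 * π * ξ * Complex.I : ℂ)‖ :=
        div_le_div_of_nonneg_right h1 (norm_nonneg _)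
    _ ≤ (Real.exp θ + 1) / (2 * π * |ξ|) :=
        div_le_div_of_nonneg_left (by positivity) hden (two_pi_mul_abs_le_norm ξ)

/-- **Square bound for the multiplier**: for `0 ≤ θ ≤ Θ ≤ 2` and `ξ ≠ 0`,
`‖κ_θ(ξ)‖² ≤ e⁴ min(Θ², 1/ξ²)`. [folklore] -/
theorem norm_sq_wTransform_le {θ Θ : ℝ} (hθ : 0 ≤ θ) (hθΘ : θ ≤ Θ) (hΘ : Θ ≤ 2) {ξ : ℝ} (hξ : ξ ≠ 0) :
    ‖wTransform θ ξ‖ ^ 2 ≤ Real.exp 4 * min (Θ ^ 2) (1 / ξ ^ 2) := by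
  have he : Real.exp θ ≤ Real.exp 2 := Real.exp_le_exp.2 (hθΘ.trans hΘ)
  have he2 : Real.exp 2 ^ 2 = Real.exp 4 := by rw [← Real.exp_nat_mul]; norm_num
  have hn := norm_nonneg (wTransform θ ξ)
  rcases le_total (Θ ^ 2) (1 / ξ ^ 2) with hmin | hmin
  · rw [min_eq_left hmin]
    have h1 := norm_wTransform_le ξ hθ
    calc ‖wTransform θ ξ‖ ^ 2 ≤ (θ * Real.exp θ) ^ 2 := pow_le_pow_left₀ hn h1 2
      _ ≤ (Θ * Real.exp 2) ^ 2 := by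
          refine pow_le_pow_left₀ (by positivity) ?_ 2
          exact mul_le_mul hθΘ he (Real.exp_pos θ).le (hθ.trans hθΘ)
      _ = Real.exp 4 * Θ ^ 2 := by rw [mul_pow, he2]; ring
  · rw [min_eq_right hmin]
    have h1 := norm_wTransform_le_inv θ hξ
    have hπ : (3 : ℝ) < π := Real.pi_gt_three
    have hξ2 : 0 < ξ ^ 2 := by positivity
    have habs : |ξ| ^ 2 = ξ ^ 2 := sq_abs ξ
    calc ‖wTransform θ ξ‖ ^ 2 ≤ ((Real.exp θ + 1) / (2 * π * |ξ|)) ^ 2 := pow_le_pow_left₀ hn h1 2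
      _ ≤ ((Real.exp 2 + 1) / (2 * π * |ξ|)) ^ 2 := by gcongr
      _ = (Real.exp 2 + 1) ^ 2 / (4 * π ^ 2) * (1 / ξ ^ 2) := by
          rw [div_pow, mul_pow, mul_pow, habs]; field_simp; ring
      _ ≤ Real.exp 4 * (1 / ξ ^ 2) := by
          refine mul_le_mul_of_nonneg_right ?_ (by positivity)
          rw [div_le_iff₀ (by positivity), ← he2]
          have h3 : (1 : ℝ) ≤ Real.exp 2 := Real.one_le_exp (by norm_num)
          have h4 : (Real.exp 2 + 1) ^ 2 ≤ (2 * Real.exp 2) ^ 2 := by gcongr; linarith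
          have hπ2 : (1 : ℝ) ≤ π ^ 2 := by nlinarith
          have h5 : (2 * Real.exp 2) ^ 2 ≤ Real.exp 2 ^ 2 * (4 * π ^ 2) := by
            rw [show (2 * Real.exp 2) ^ 2 = Real.exp 2 ^ 2 * 4 * 1 by ring, mul_assoc]
            exact mul_le_mul_of_nonneg_left (by nlinarith) (by positivity)
          linarith

/-! ### The complex Dirichlet sum -/

/-- `‖A(ξ)‖ ≤ ∑ ‖b_m‖`. [folklore] -/
theorem norm_dirichletSumC_le (s : Finset ℕ) (b : ℕ → ℂ) (ξ : ℝ) :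
    ‖dirichletSumC s b ξ‖ ≤ ∑ m ∈ s, ‖b m‖ := by
  unfold dirichletSumC
  refine (norm_sum_le _ _).trans (Finset.sum_le_sum fun m _ => ?_)
  rw [norm_mul, Complex.norm_exp_ofReal_mul_I, mul_one]

/-- `A` is continuous. [folklore] -/
theorem continuous_dirichletSumC (s : Finset ℕ) (b : ℕ → ℂ) : Continuous (dirichletSumC s b) := by
  unfold dirichletSumC
  fun_prop

/-! ### Plancherel for the weighted window -/

/-- `min(a, 1/x) ≤ (a + 1)/(1 + x)` for `x > 0`. [folklore] -/
theorem min_inv_le (a : ℝ) {x : ℝ} (hx : 0 < x) : min a (1 / x) ≤ (a + 1) / (1 + x) := by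
  rw [le_div_iff₀ (by linarith)]
  rcases le_total a (1 / x) with h | h
  · rw [min_eq_left h]
    have : a * x ≤ 1 := by rwa [le_div_iff₀ hx] at h
    nlinarith
  · rw [min_eq_right h]
    have h' : 1 ≤ a * x := by rwa [div_le_iff₀ hx] at h
    rw [div_mul_eq_mul_div, div_le_iff₀ hx]
    nlinarith

/-- The frequency-side majorant `ξ ↦ min(Θ², 1/ξ²) ‖A(ξ)‖²` is integrable. [folklore] -/
theorem integrable_min_mul_norm_sq (s : Finset ℕ) (b : ℕ → ℂ) (Θ : ℝ) :
    Integrable (fun ξ : ℝ => min (Θ ^ 2) (1 / ξ ^ 2) * ‖dirichletSumC s b ξ‖ ^ 2) := by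
  set β := ∑ m ∈ s, ‖b m‖ with hβ
  have hmeas : AEStronglyMeasurable (fun ξ : ℝ => min (Θ ^ 2) (1 / ξ ^ 2) * ‖dirichletSumC s b ξ‖ ^ 2) volume := by
    refine Measurable.aestronglyMeasurable ?_
    exact (measurable_const.min (measurable_const.div (measurable_id.pow_const 2))).mul
      ((continuous_dirichletSumC s b).norm.measurable.pow_const 2)
  refine ((integrable_inv_one_add_sq.const_mul ((Θ ^ 2 + 1) * β ^ 2))).mono' hmeas ?_
  refine Eventually.of_forall fun ξ => ?_
  have hA : ‖dirichletSumC s b ξ‖ ^ 2 ≤ β ^ 2 :=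
    pow_le_pow_left₀ (norm_nonneg _) (norm_dirichletSumC_le s b ξ) 2
  have hmin0 : 0 ≤ min (Θ ^ 2) (1 / ξ ^ 2) := le_min (sq_nonneg _) (by positivity)
  rw [Real.norm_eq_abs, abs_of_nonneg (mul_nonneg hmin0 (sq_nonneg _))]
  rcases eq_or_ne ξ 0 with hξ | hξ
  · subst hξ
    simp only [ne_eq, OfNat.ofNat_ne_zero, not_false_eq_true, zero_pow, div_zero, add_zero, inv_one, mul_one]
    calc min (Θ ^ 2) 0 * ‖dirichletSumC s b 0‖ ^ 2 ≤ 0 * ‖dirichletSumC s b 0‖ ^ 2 :=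
          mul_le_mul_of_nonneg_right (min_le_right _ _) (sq_nonneg _)
      _ ≤ (Θ ^ 2 + 1) * β ^ 2 := by rw [zero_mul]; positivity
  · have hx : 0 < ξ ^ 2 := by positivity
    have h1 := min_inv_le (Θ ^ 2) hx
    calc min (Θ ^ 2) (1 / ξ ^ 2) * ‖dirichletSumC s b ξ‖ ^ 2 ≤ (Θ ^ 2 + 1) / (1 + ξ ^ 2) * β ^ 2 :=
          mul_le_mul h1 hA (sq_nonneg _) (by positivity)
      _ = (Θ ^ 2 + 1) * β ^ 2 * (1 + ξ ^ 2)⁻¹ := by ring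

/-- **Plancherel bound for the weighted window**: for `0 ≤ θ ≤ Θ ≤ 2`,
`∫ ‖G_θ(v)‖² dv ≤ e⁴ ∫ min(Θ², 1/ξ²) ‖A(ξ)‖² dξ`. [folklore] -/
theorem integral_norm_sq_wlogWindow_le (s : Finset ℕ) (b : ℕ → ℂ) {θ Θ : ℝ} (hθ : 0 ≤ θ) (hθΘ : θ ≤ Θ)
    (hΘ : Θ ≤ 2) :
    ∫ v, ‖wlogWindow s b θ v‖ ^ 2
      ≤ Real.exp 4 * ∫ ξ, min (Θ ^ 2) (1 / ξ ^ 2) * ‖dirichletSumC s b ξ‖ ^ 2 := by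
  rw [← Literature.Analysis.FunctionSpaces.integral_norm_sq_fourierIntegral_eq (integrable_wlogWindow s b θ)
    (memLp_two_wlogWindow s b θ), ← integral_const_mul]
  have hF := Literature.Analysis.FunctionSpaces.memLp_two_fourierIntegral (integrable_wlogWindow s b θ)
    (memLp_two_wlogWindow s b θ)
  have i1 : Integrable (fun ξ ↦ ‖𝓕 (wlogWindow s b θ) ξ‖ ^ 2) (volume : Measure ℝ) :=
    (memLp_two_iff_integrable_sq_norm hF.1).1 hF
  refine integral_mono_ae i1 ((integrable_min_mul_norm_sq s b Θ).const_mul _) ?_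
  have h0 : ∀ᵐ ξ : ℝ, ξ ∉ ({0} : Set ℝ) := measure_eq_zero_iff_ae_notMem.1 (measure_singleton 0)
  filter_upwards [h0] with ξ hξ
  rw [Set.mem_singleton_iff] at hξ
  rw [fourier_wlogWindow s b hθ, norm_mul, mul_pow, ← mul_assoc]
  exact mul_le_mul_of_nonneg_right (norm_sq_wTransform_le hθ hθΘ hΘ hξ) (sq_nonneg _)


/-! ### Joint measurability and the width-averaged energy -/

/-- `(θ, v) ↦ G_θ(v)` is jointly measurable. [folklore] -/
theorem measurable_uncurry_wlogWindow (s : Finset ℕ) (b : ℕ → ℂ) :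
    Measurable (fun p : ℝ × ℝ => wlogWindow s b p.1 p.2) := by
  unfold wlogWindow
  refine Finset.measurable_sum _ fun m _ => ?_
  have hexp : Measurable fun p : ℝ × ℝ => ((Real.exp (Real.log m - p.2) : ℝ) : ℂ) := by fun_prop
  refine (measurable_const.mul hexp).mul ?_
  have : (fun p : ℝ × ℝ => (Set.Ico (Real.log m - p.1) (Real.log m)).indicator (1 : ℝ → ℂ) p.2)
      = ({p : ℝ × ℝ | Real.log m - p.1 ≤ p.2} ∩ {p : ℝ × ℝ | p.2 < Real.log m}).indicator 1 := by
    funext p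
    by_cases h : p.2 ∈ Set.Ico (Real.log m - p.1) (Real.log m)
    · rw [Set.indicator_of_mem h, Set.indicator_of_mem]
      · rfl
      · exact ⟨h.1, h.2⟩
    · rw [Set.indicator_of_notMem h, Set.indicator_of_notMem]
      intro h'
      exact h ⟨h'.1, h'.2⟩
  rw [this]
  refine measurable_const.indicator (MeasurableSet.inter ?_ ?_)
  · exact measurableSet_le (by fun_prop) (by fun_prop)
  · exact measurableSet_lt (by fun_prop) (by fun_prop)

/-- `Q(u) = ∫_0^{Θ} ‖G_θ(u)‖² dθ`: the window energy at `u` integrated over the widths. [folklore] -/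
def Qint (s : Finset ℕ) (b : ℕ → ℂ) (Θ u : ℝ) : ℝ :=
  ∫ θ in (0 : ℝ)..Θ, ‖wlogWindow s b θ u‖ ^ 2

/-- `θ ↦ ‖G_θ(u)‖²` is integrable on `[0, Θ]`. [folklore] -/
theorem integrableOn_norm_sq_wlogWindow (s : Finset ℕ) (b : ℕ → ℂ) (u Θ : ℝ) :
    IntegrableOn (fun θ => ‖wlogWindow s b θ u‖ ^ 2) (Set.Icc 0 Θ) := by
  have hmeas : Measurable fun θ => ‖wlogWindow s b θ u‖ ^ 2 := by
    have h := (measurable_uncurry_wlogWindow s b).comp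
      (measurable_id.prodMk (measurable_const (a := u)) : Measurable fun θ : ℝ => (θ, u))
    exact h.norm.pow_const 2
  refine Measure.integrableOn_of_bounded (M := (Real.exp Θ * ∑ m ∈ s, ‖b m‖) ^ 2)
    (by rw [Real.volume_Icc]; exact ENNReal.ofReal_lt_top.ne) hmeas.aestronglyMeasurable ?_
  refine (ae_restrict_iff' measurableSet_Icc).2 (Eventually.of_forall fun θ hθ => ?_)
  rw [Real.norm_eq_abs, abs_of_nonneg (sq_nonneg _)]
  refine pow_le_pow_left₀ (norm_nonneg _) ((norm_wlogWindow_le s b θ u).trans ?_) 2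
  exact mul_le_mul_of_nonneg_right (Real.exp_le_exp.2 hθ.2) (Finset.sum_nonneg fun _ _ => norm_nonneg _)

/-- Interval integrability of `θ ↦ ‖G_θ(u)‖²` on subintervals of `[0, Θ]`. [folklore] -/
theorem intervalIntegrable_norm_sq_wlogWindow (s : Finset ℕ) (b : ℕ → ℂ) (u : ℝ) {α β Θ : ℝ}
    (hα : 0 ≤ α) (hαβ : α ≤ β) (hβ : β ≤ Θ) :
    IntervalIntegrable (fun θ => ‖wlogWindow s b θ u‖ ^ 2) volume α β := by
  rw [intervalIntegrable_iff_integrableOn_Icc_of_le hαβ]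
  exact (integrableOn_norm_sq_wlogWindow s b u Θ).mono_set (Set.Icc_subset_Icc hα hβ)

/-- `0 ≤ Q` for `Θ ≥ 0`. [folklore] -/
theorem Qint_nonneg (s : Finset ℕ) (b : ℕ → ℂ) {Θ : ℝ} (hΘ : 0 ≤ Θ) (u : ℝ) : 0 ≤ Qint s b Θ u :=
  intervalIntegral.integral_nonneg hΘ fun _ _ => sq_nonneg _

/-- The shifted width integral is dominated by `Q`: `∫_{α}^{Θ} ‖G_{θ-c}(u)‖² ≤ Q(u)` for
`0 ≤ c ≤ α ≤ Θ`. [folklore] -/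
theorem integral_shift_le_Qint (s : Finset ℕ) (b : ℕ → ℂ) {α Θ c : ℝ} (u : ℝ)
    (hc0 : 0 ≤ c) (hc : c ≤ α) (hαΘ : α ≤ Θ) :
    ∫ θ in α..Θ, ‖wlogWindow s b (θ - c) u‖ ^ 2 ≤ Qint s b Θ u := by
  rw [intervalIntegral.integral_comp_sub_right (fun θ => ‖wlogWindow s b θ u‖ ^ 2) c, Qint]
  refine intervalIntegral.integral_mono_interval (by linarith) (by linarith) (by linarith)
    (Eventually.of_forall fun θ => sq_nonneg _) ?_
  exact intervalIntegrable_norm_sq_wlogWindow _ _ u le_rfl (by linarith) le_rfl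

/-! ### The support set, the coefficients `b_m = a_m/m`, and the window identity -/

/-- The integers of `[X, 2X]`. [folklore] -/
def suppS (X : ℝ) : Finset ℕ := Icc ⌈X⌉₊ ⌊2 * X⌋₊

/-- `b_m = a_m / m`. [folklore] -/
def coeffC (a : ℕ → ℂ) (m : ℕ) : ℂ := a m / m

/-- Members of `[X, 2X]` are `≥ X`. [folklore] -/
theorem X_le_of_mem_suppS {X : ℝ} {m : ℕ} (hm : m ∈ suppS X) : X ≤ m := by
  rw [suppS, Finset.mem_Icc] at hm
  exact (Nat.le_ceil X).trans (by exact_mod_cast hm.1)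

/-- Members of `[X, 2X]` are `≤ 2X` (`X ≥ 0`). [folklore] -/
theorem le_twoX_of_mem_suppS {X : ℝ} (hX : 0 ≤ X) {m : ℕ} (hm : m ∈ suppS X) : (m : ℝ) ≤ 2 * X := by
  rw [suppS, Finset.mem_Icc] at hm
  exact (Nat.cast_le.2 hm.2).trans (Nat.floor_le (by linarith))

/-- Members of `[X, 2X]` are positive when `X ≥ 1`. [folklore] -/
theorem pos_of_mem_suppS {X : ℝ} (hX : 1 ≤ X) {m : ℕ} (hm : m ∈ suppS X) : (0 : ℝ) < m :=
  lt_of_lt_of_le (by linarith) (X_le_of_mem_suppS hm)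

/-- `‖b_m‖ ≤ 1/X` on `[X, 2X]`. [folklore] -/
theorem norm_coeffC_le {a : ℕ → ℂ} (ha : ∀ m, ‖a m‖ ≤ 1) {X : ℝ} (hX : 1 ≤ X) {m : ℕ}
    (hm : m ∈ suppS X) : ‖coeffC a m‖ ≤ 1 / X := by
  have hm0 := pos_of_mem_suppS hX hm
  rw [coeffC, norm_div, Complex.norm_natCast]
  calc ‖a m‖ / m ≤ 1 / m := div_le_div_of_nonneg_right (ha m) hm0.le
    _ ≤ 1 / X := one_div_le_one_div_of_le (by linarith) (X_le_of_mem_suppS hm)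

/-- `#[X, 2X] ≤ X + 1`. [folklore] -/
theorem card_suppS_le {X : ℝ} (hX : 1 ≤ X) : (#(suppS X) : ℝ) ≤ X + 1 := by
  rw [suppS, Nat.card_Icc]
  have hc : X ≤ (⌈X⌉₊ : ℝ) := Nat.le_ceil X
  have hf : (⌊2 * X⌋₊ : ℝ) ≤ 2 * X := Nat.floor_le (by linarith)
  rcases le_or_gt ⌈X⌉₊ (⌊2 * X⌋₊ + 1) with h3 | h3
  · rw [Nat.cast_sub h3]; push_cast; linarith
  · rw [Nat.sub_eq_zero_of_le h3.le]; push_cast; linarith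

/-- `β = ∑ ‖b_m‖ ≤ 2`. [folklore] -/
theorem sum_norm_coeffC_le {a : ℕ → ℂ} (ha : ∀ m, ‖a m‖ ≤ 1) {X : ℝ} (hX : 1 ≤ X) :
    ∑ m ∈ suppS X, ‖coeffC a m‖ ≤ 2 := by
  calc ∑ m ∈ suppS X, ‖coeffC a m‖ ≤ ∑ m ∈ suppS X, 1 / X :=
        Finset.sum_le_sum fun m hm => norm_coeffC_le ha hX hm
    _ = #(suppS X) * (1 / X) := by rw [Finset.sum_const, nsmul_eq_mul]
    _ ≤ (X + 1) * (1 / X) := mul_le_mul_of_nonneg_right (card_suppS_le hX) (by positivity)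
    _ = 1 + 1 / X := by field_simp
    _ ≤ 2 := by
        have : 1 / X ≤ 1 := by rw [div_le_one (by linarith)]; exact hX
        linarith

/-- The weighted log-window at `v = log y` is the weighted multiplicative window `(y, y e^θ]`:
`G_θ(log y) = ∑_{y < m ≤ y e^θ} b_m (m / y)`. [folklore] -/
theorem wlogWindow_log (X : ℝ) (hX : 1 ≤ X) (b : ℕ → ℂ) {y : ℝ} (hy : 0 < y) (θ : ℝ) :
    wlogWindow (suppS X) b θ (Real.log y)
      = ∑ m ∈ (suppS X).filter (fun m : ℕ => y < m ∧ (m : ℝ) ≤ y * Real.exp θ),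
          b m * (((m : ℝ) / y : ℝ) : ℂ) := by
  rw [wlogWindow_apply]
  have hfilt : (suppS X).filter (fun m : ℕ => Real.log m - θ ≤ Real.log y ∧ Real.log y < Real.log m)
      = (suppS X).filter (fun m : ℕ => y < m ∧ (m : ℝ) ≤ y * Real.exp θ) := by
    ext m
    simp only [Finset.mem_filter, and_congr_right_iff]
    intro hm
    have hm0 : (0 : ℝ) < m := pos_of_mem_suppS hX hm
    rw [Real.log_lt_log_iff hy hm0, sub_le_iff_le_add, ← Real.log_exp θ, ← Real.log_mul hy.ne'
      (Real.exp_pos θ).ne', Real.log_exp, Real.log_le_log_iff hm0 (mul_pos hy (Real.exp_pos θ))]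
    tauto
  rw [hfilt]
  refine Finset.sum_congr rfl fun m hm => ?_
  have hm0 : (0 : ℝ) < m := pos_of_mem_suppS hX (Finset.mem_filter.1 hm).1
  rw [Real.exp_sub, Real.exp_log hm0, Real.exp_log hy]

/-- **The window identity** (Saffari–Vaughan form, exact): for `z = y e^θ ≥ y + h`,
`∑_{y < m ≤ y+h} a_m = y G_θ(log y) - (y + h) G_{θ-c}(log(y + h))`, `c = log(y+h) - log y`,
`G` the weighted log-window of `b_m = a_m/m`. [cite: MatomakiRadziwillAnnals2016, §7, proof of Lemma 14] -/
theorem sum_window_eq (X : ℝ) (hX : 1 ≤ X) (a : ℕ → ℂ) {y h θ : ℝ} (hy : 0 < y) (hh : 0 ≤ h)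
    (hθ : y + h ≤ y * Real.exp θ) :
    ∑ m ∈ (suppS X).filter (fun m : ℕ => y < m ∧ (m : ℝ) ≤ y + h), a m
      = (y : ℂ) * wlogWindow (suppS X) (coeffC a) θ (Real.log y)
        - ((y + h : ℝ) : ℂ) * wlogWindow (suppS X) (coeffC a)
            (θ - (Real.log (y + h) - Real.log y)) (Real.log (y + h)) := by
  have hyh : 0 < y + h := by linarith
  rw [wlogWindow_log X hX _ hy, wlogWindow_log X hX _ hyh]
  have hz : (y + h) * Real.exp (θ - (Real.log (y + h) - Real.log y)) = y * Real.exp θ := by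
    rw [Real.exp_sub, Real.exp_sub, Real.exp_log hyh, Real.exp_log hy]
    field_simp
  rw [hz, Finset.mul_sum, Finset.mul_sum]
  -- rewrite each weighted term back to `a m`
  have e1 : ∀ m ∈ (suppS X).filter (fun m : ℕ => y < m ∧ (m : ℝ) ≤ y * Real.exp θ),
      (y : ℂ) * (coeffC a m * (((m : ℝ) / y : ℝ) : ℂ)) = a m := by
    intro m hm
    have hm0 : (0 : ℝ) < m := pos_of_mem_suppS hX (Finset.mem_filter.1 hm).1
    rw [coeffC]
    have : (m : ℂ) ≠ 0 := by exact_mod_cast hm0.ne'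
    have hy' : (y : ℂ) ≠ 0 := by exact_mod_cast hy.ne'
    push_cast
    field_simp
  have e2 : ∀ m ∈ (suppS X).filter (fun m : ℕ => y + h < m ∧ (m : ℝ) ≤ y * Real.exp θ),
      ((y + h : ℝ) : ℂ) * (coeffC a m * (((m : ℝ) / (y + h) : ℝ) : ℂ)) = a m := by
    intro m hm
    have hm0 : (0 : ℝ) < m := pos_of_mem_suppS hX (Finset.mem_filter.1 hm).1
    rw [coeffC]
    have : (m : ℂ) ≠ 0 := by exact_mod_cast hm0.ne'
    have hy' : ((y + h : ℝ) : ℂ) ≠ 0 := by exact_mod_cast hyh.ne'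
    push_cast at hy' ⊢
    field_simp
  rw [Finset.sum_congr rfl e1, Finset.sum_congr rfl e2, eq_sub_iff_add_eq]
  rw [← Finset.sum_filter_add_sum_filter_not ((suppS X).filter fun m : ℕ => y < m ∧ (m : ℝ) ≤ y * Real.exp θ)
    (fun m : ℕ => (m : ℝ) ≤ y + h)]
  congr 1
  · refine Finset.sum_congr ?_ fun _ _ => rfl
    ext m; simp only [Finset.mem_filter]
    constructor
    · rintro ⟨hm, h1, h2⟩; exact ⟨⟨hm, h1, h2.trans hθ⟩, h2⟩
    · rintro ⟨⟨hm, h1, h2⟩, h3⟩; exact ⟨hm, h1, h3⟩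
  · refine Finset.sum_congr ?_ fun _ _ => rfl
    ext m; simp only [Finset.mem_filter, not_le]
    constructor
    · rintro ⟨hm, h1, h2⟩; exact ⟨⟨hm, by linarith, h2⟩, h1⟩
    · rintro ⟨⟨hm, h1, h2⟩, h3⟩; exact ⟨hm, h3, h2⟩

/-- For non-integral `y > 0` and `h ≥ 0`, `X ≥ 0`, the integers of `[y, y + h]` lying in `[X, 2X]`
are the `m ∈ [X, 2X]` with `y < m ≤ y + h`. [folklore] -/
theorem filter_Icc_eq {X y h : ℝ} (hX : 0 ≤ X) (hy : 0 < y) (hh : 0 ≤ h) (hyN : ∀ n : ℕ, (n : ℝ) ≠ y) :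
    (Finset.Icc ⌈y⌉₊ ⌊y + h⌋₊).filter (fun m : ℕ => X ≤ m ∧ (m : ℝ) ≤ 2 * X)
      = (suppS X).filter (fun m : ℕ => y < m ∧ (m : ℝ) ≤ y + h) := by
  have hfl : ∀ m : ℕ, m ≤ ⌊y + h⌋₊ ↔ (m : ℝ) ≤ y + h := fun m => Nat.le_floor_iff (by linarith)
  have hfl2 : ∀ m : ℕ, m ≤ ⌊2 * X⌋₊ ↔ (m : ℝ) ≤ 2 * X := fun m => Nat.le_floor_iff (by linarith)
  ext m
  simp only [Finset.mem_Icc, Finset.mem_filter, suppS, Nat.ceil_le, hfl, hfl2]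
  constructor
  · rintro ⟨⟨h1, h2⟩, h3, h4⟩
    exact ⟨⟨h3, h4⟩, lt_of_le_of_ne h1 (fun h => hyN m h.symm), h2⟩
  · rintro ⟨⟨h3, h4⟩, h1, h2⟩
    exact ⟨⟨h1.le, h2⟩, h3, h4⟩


/-! ### Pointwise bound for one short average and averaging over the width -/

open Literature.NumberTheory.Sieve.MatomakiRadziwillL14 (thetaA thetaB cShift thetaA_nonneg thetaA_le
  thetaB_le thetaA_le_thetaB cShift_nonneg cShift_le_thetaA add_le_mul_exp le_inv_mul_integral_of_forall_le
  setIntegral_comp_log_add_le ae_not_natCast)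

/-- The short average `h⁻¹ ∑_{y ≤ m ≤ y + h, X ≤ m ≤ 2X} a_m` of the statement. [folklore] -/
def shortAvg (X h : ℝ) (a : ℕ → ℂ) (y : ℝ) : ℂ :=
  (h : ℂ)⁻¹ * ∑ m ∈ (Finset.Icc ⌈y⌉₊ ⌊y + h⌋₊).filter (fun m : ℕ => X ≤ m ∧ (m : ℝ) ≤ 2 * X), a m

/-- `‖αP - βQ‖² ≤ (α² + β²)(‖P‖² + ‖Q‖²)` (Cauchy–Schwarz). [folklore] -/
theorem norm_sq_sub_smul_le (α β : ℝ) (P Q : ℂ) :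
    ‖(α : ℂ) * P - (β : ℂ) * Q‖ ^ 2 ≤ (α ^ 2 + β ^ 2) * (‖P‖ ^ 2 + ‖Q‖ ^ 2) := by
  have h1 : ‖(α : ℂ) * P - (β : ℂ) * Q‖ ≤ |α| * ‖P‖ + |β| * ‖Q‖ := by
    refine (norm_sub_le _ _).trans ?_
    rw [norm_mul, norm_mul, Complex.norm_real, Complex.norm_real, Real.norm_eq_abs, Real.norm_eq_abs]
  have h2 : (|α| * ‖P‖ + |β| * ‖Q‖) ^ 2 ≤ (α ^ 2 + β ^ 2) * (‖P‖ ^ 2 + ‖Q‖ ^ 2) := by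
    rw [← sq_abs α, ← sq_abs β]
    nlinarith [sq_nonneg (|α| * ‖Q‖ - |β| * ‖P‖), abs_nonneg α, abs_nonneg β, norm_nonneg P, norm_nonneg Q]
  exact (pow_le_pow_left₀ (norm_nonneg _) h1 2).trans h2

/-- **One window, pointwise.** For non-integral `y ∈ [X, 2X]`, `0 < h ≤ X` and `θ ≥ θ_a`:
`‖h⁻¹ ∑_{y ≤ m ≤ y+h} a_m‖² ≤ 13 (X/h)² (‖G_θ(log y)‖² + ‖G_{θ - c(y)}(log(y+h))‖²)`, exactly (no error
term), by the window identity `sum_window_eq`. [cite: MatomakiRadziwillTao2015, Appendix A (Parseval bound)] -/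
theorem norm_sq_shortAvg_le_pointwise (a : ℕ → ℂ) {X : ℝ} (hX : 1 ≤ X) {y h θ : ℝ}
    (hy : X ≤ y) (hy2 : y ≤ 2 * X) (hh : 0 < h) (hhX : h ≤ X) (hyN : ∀ n : ℕ, (n : ℝ) ≠ y)
    (hθ : thetaA X h ≤ θ) :
    ‖shortAvg X h a y‖ ^ 2
      ≤ 13 * (X / h) ^ 2 * (‖wlogWindow (suppS X) (coeffC a) θ (Real.log y)‖ ^ 2
          + ‖wlogWindow (suppS X) (coeffC a) (θ - cShift y h) (Real.log (y + h))‖ ^ 2) := by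
  have hX0 : 0 < X := by linarith
  have hy0 : 0 < y := by linarith
  set P := wlogWindow (suppS X) (coeffC a) θ (Real.log y)
  set Q := wlogWindow (suppS X) (coeffC a) (θ - cShift y h) (Real.log (y + h))
  have hsum : ∑ m ∈ (Finset.Icc ⌈y⌉₊ ⌊y + h⌋₊).filter (fun m : ℕ => X ≤ m ∧ (m : ℝ) ≤ 2 * X), a m
      = (y : ℂ) * P - ((y + h : ℝ) : ℂ) * Q := by
    rw [filter_Icc_eq hX0.le hy0 hh.le hyN]
    exact sum_window_eq X hX a hy0 hh.le (add_le_mul_exp hX0 hy hh.le hθ)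
  rw [shortAvg, hsum, norm_mul, mul_pow, norm_inv, Complex.norm_real, Real.norm_eq_abs, abs_of_pos hh]
  have hcs := norm_sq_sub_smul_le y (y + h) P Q
  have hcoef : y ^ 2 + (y + h) ^ 2 ≤ 13 * X ^ 2 := by nlinarith
  have hPQ : 0 ≤ ‖P‖ ^ 2 + ‖Q‖ ^ 2 := by positivity
  calc h⁻¹ ^ 2 * ‖(y : ℂ) * P - ((y + h : ℝ) : ℂ) * Q‖ ^ 2
      ≤ h⁻¹ ^ 2 * ((13 * X ^ 2) * (‖P‖ ^ 2 + ‖Q‖ ^ 2)) := by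
        refine mul_le_mul_of_nonneg_left (hcs.trans ?_) (by positivity)
        exact mul_le_mul_of_nonneg_right hcoef hPQ
    _ = 13 * (X / h) ^ 2 * (‖P‖ ^ 2 + ‖Q‖ ^ 2) := by field_simp

/-- **One window, after averaging over the widths `θ ∈ [θ_a, θ_b]`** (the interval has length `h/X`):
`‖h⁻¹ ∑_{y ≤ m ≤ y+h} a_m‖² ≤ 13 (X/h)³ (Q(log y) + Q(log(y + h)))` with `Q(u) = ∫_0^{θ_b} ‖G_θ(u)‖² dθ`.
[cite: MatomakiRadziwillAnnals2016, §7, proof of Lemma 14 (averaging over the window length)] -/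
theorem norm_sq_shortAvg_le_Qint (a : ℕ → ℂ) {X : ℝ} (hX : 1 ≤ X) {y h : ℝ}
    (hy : X ≤ y) (hy2 : y ≤ 2 * X) (hh : 0 < h) (hhX : h ≤ X) (hyN : ∀ n : ℕ, (n : ℝ) ≠ y) :
    ‖shortAvg X h a y‖ ^ 2
      ≤ 13 * (X / h) ^ 3 * (Qint (suppS X) (coeffC a) (thetaB X h) (Real.log y)
          + Qint (suppS X) (coeffC a) (thetaB X h) (Real.log (y + h))) := by
  have hX0 : 0 < X := by linarith
  have hy0 : 0 < y := by linarith
  set s := suppS X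
  set b := coeffC a
  have hA0 := thetaA_nonneg hX0 hh.le
  have hAB := thetaA_le_thetaB hX0 hh.le
  have hc0 := cShift_nonneg hy0 hh.le
  have hcA := cShift_le_thetaA hX0 hy hh.le
  have hlt : thetaA X h < thetaB X h := by
    have : 0 < h / X := by positivity
    rw [thetaB]; linarith
  have hω : thetaB X h - thetaA X h = h / X := by rw [thetaB]; ring
  set g : ℝ → ℝ := fun θ => 13 * (X / h) ^ 2 * (‖wlogWindow s b θ (Real.log y)‖ ^ 2
      + ‖wlogWindow s b (θ - cShift y h) (Real.log (y + h))‖ ^ 2) with hg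
  have hpt : ∀ θ ∈ Set.Icc (thetaA X h) (thetaB X h), ‖shortAvg X h a y‖ ^ 2 ≤ g θ :=
    fun θ hθ => norm_sq_shortAvg_le_pointwise a hX hy hy2 hh hhX hyN hθ.1
  have i1 : IntervalIntegrable (fun θ => ‖wlogWindow s b θ (Real.log y)‖ ^ 2) volume
      (thetaA X h) (thetaB X h) := intervalIntegrable_norm_sq_wlogWindow s b _ hA0 hAB le_rfl
  have i2 : IntervalIntegrable (fun θ => ‖wlogWindow s b (θ - cShift y h) (Real.log (y + h))‖ ^ 2)
      volume (thetaA X h) (thetaB X h) := by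
    have h2 := (intervalIntegrable_norm_sq_wlogWindow s b (Real.log (y + h)) (α := thetaA X h - cShift y h)
      (β := thetaB X h - cShift y h) (Θ := thetaB X h) (by linarith) (by linarith) (by linarith)).comp_sub_right
      (cShift y h)
    simp only [sub_add_cancel] at h2
    exact h2
  have hint : IntervalIntegrable g volume (thetaA X h) (thetaB X h) := (i1.add i2).const_mul _
  have step : ‖shortAvg X h a y‖ ^ 2 ≤ (h / X)⁻¹ * ∫ θ in thetaA X h..thetaB X h, g θ := by
    rw [← hω]
    exact le_inv_mul_integral_of_forall_le hlt hint hpt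
  have j1 : ∫ θ in thetaA X h..thetaB X h, ‖wlogWindow s b θ (Real.log y)‖ ^ 2
      ≤ Qint s b (thetaB X h) (Real.log y) := by
    have := integral_shift_le_Qint s b (Real.log y) le_rfl hA0 hAB (c := 0)
    simpa using this
  have j2 : ∫ θ in thetaA X h..thetaB X h, ‖wlogWindow s b (θ - cShift y h) (Real.log (y + h))‖ ^ 2
      ≤ Qint s b (thetaB X h) (Real.log (y + h)) :=
    integral_shift_le_Qint s b (Real.log (y + h)) hc0 hcA hAB
  have hI : ∫ θ in thetaA X h..thetaB X h, g θ
      = 13 * (X / h) ^ 2 * ((∫ θ in thetaA X h..thetaB X h, ‖wlogWindow s b θ (Real.log y)‖ ^ 2)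
        + ∫ θ in thetaA X h..thetaB X h, ‖wlogWindow s b (θ - cShift y h) (Real.log (y + h))‖ ^ 2) := by
    rw [hg, intervalIntegral.integral_const_mul, intervalIntegral.integral_add i1 i2]
  rw [hI] at step
  have hcoef : (h / X)⁻¹ * (13 * (X / h) ^ 2) = 13 * (X / h) ^ 3 := by field_simp
  calc ‖shortAvg X h a y‖ ^ 2 ≤ (h / X)⁻¹ * (13 * (X / h) ^ 2 *
        ((∫ θ in thetaA X h..thetaB X h, ‖wlogWindow s b θ (Real.log y)‖ ^ 2)
        + ∫ θ in thetaA X h..thetaB X h, ‖wlogWindow s b (θ - cShift y h) (Real.log (y + h))‖ ^ 2)) := step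
    _ = 13 * (X / h) ^ 3 * ((∫ θ in thetaA X h..thetaB X h, ‖wlogWindow s b θ (Real.log y)‖ ^ 2)
        + ∫ θ in thetaA X h..thetaB X h, ‖wlogWindow s b (θ - cShift y h) (Real.log (y + h))‖ ^ 2) := by
        rw [← mul_assoc, hcoef]
    _ ≤ 13 * (X / h) ^ 3 * (Qint s b (thetaB X h) (Real.log y) + Qint s b (thetaB X h) (Real.log (y + h))) :=
        mul_le_mul_of_nonneg_left (add_le_add j1 j2) (by positivity)

/-! ### Integrating over `y`: Tonelli and the change of variables `y = e^v` -/

/-- The frequency-side energy `P(Θ) = ∫ min(Θ², 1/ξ²) ‖A(ξ)‖² dξ` (two-sided). [folklore] -/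
def Pfreq (X : ℝ) (a : ℕ → ℂ) (Θ : ℝ) : ℝ :=
  ∫ ξ, min (Θ ^ 2) (1 / ξ ^ 2) * ‖dirichletSumC (suppS X) (coeffC a) ξ‖ ^ 2

/-- `0 ≤ P`. [folklore] -/
theorem Pfreq_nonneg (X : ℝ) (a : ℕ → ℂ) (Θ : ℝ) : 0 ≤ Pfreq X a Θ :=
  integral_nonneg fun ξ => mul_nonneg (le_min (sq_nonneg _) (by positivity)) (sq_nonneg _)

/-- **Tonelli step** (with a shift `d ≥ 0`): for `Θ = θ_b ≤ 2`, `y ↦ Q(log(y + d))` is integrable on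
`(A, B]` and `∫_{(A,B]} Q(log(y + d)) dy ≤ Θ (B + d) e⁴ P(Θ)` (`0 < A ≤ B`). [folklore] -/
theorem setIntegral_Qint_log_le (a : ℕ → ℂ) {X Θ A B d : ℝ} (hΘ0 : 0 ≤ Θ) (hΘ : Θ ≤ 2)
    (hA : 0 < A) (hAB : A ≤ B) (hd : 0 ≤ d) :
    IntegrableOn (fun y => Qint (suppS X) (coeffC a) Θ (Real.log (y + d))) (Set.Ioc A B)
    ∧ ∫ y in Set.Ioc A B, Qint (suppS X) (coeffC a) Θ (Real.log (y + d))
        ≤ Θ * (B + d) * (Real.exp 4 * Pfreq X a Θ) := by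
  have hB : 0 < B := by linarith
  set s := suppS X
  set b := coeffC a
  -- the integrand on the product
  set F : ℝ → ℝ → ℝ := fun y θ => ‖wlogWindow s b θ (Real.log (y + d))‖ ^ 2 with hF
  have hFmeas : Measurable (Function.uncurry F) := by
    have h1 : Measurable fun p : ℝ × ℝ => (p.2, Real.log (p.1 + d)) :=
      measurable_snd.prodMk (Real.measurable_log.comp (measurable_fst.add_const d))
    exact ((measurable_uncurry_wlogWindow s b).comp h1).norm.pow_const 2
  set μ : Measure ℝ := volume.restrict (Set.Ioc A B)
  set ν : Measure ℝ := volume.restrict (Set.Ioc 0 Θ)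
  haveI : IsFiniteMeasure μ := ⟨by simp [μ, Real.volume_Ioc]⟩
  haveI : IsFiniteMeasure ν := ⟨by simp [ν, Real.volume_Ioc]⟩
  set M := (Real.exp Θ * ∑ m ∈ s, ‖b m‖) ^ 2
  have hFbd : ∀ y, ∀ θ ∈ Set.Ioc 0 Θ, F y θ ≤ M := fun y θ hθ =>
    pow_le_pow_left₀ (norm_nonneg _) ((norm_wlogWindow_le s b θ _).trans
      (mul_le_mul_of_nonneg_right (Real.exp_le_exp.2 hθ.2) (Finset.sum_nonneg fun _ _ => norm_nonneg _))) 2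
  have hFint : Integrable (Function.uncurry F) (μ.prod ν) := by
    refine Integrable.of_bound hFmeas.aestronglyMeasurable M ?_
    have : ∀ᵐ p ∂(μ.prod ν), p.2 ∈ Set.Ioc 0 Θ :=
      (Measure.quasiMeasurePreserving_snd (μ := μ) (ν := ν)).ae (ae_restrict_mem measurableSet_Ioc)
    filter_upwards [this] with p hp
    rw [Real.norm_eq_abs, Function.uncurry, abs_of_nonneg (sq_nonneg _)]
    exact hFbd p.1 p.2 hp
  have hQ : ∀ y, Qint s b Θ (Real.log (y + d)) = ∫ θ, F y θ ∂ν := by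
    intro y
    rw [Qint, intervalIntegral.integral_of_le hΘ0]
  have hQfun : (fun y => Qint s b Θ (Real.log (y + d))) = fun y => ∫ θ, F y θ ∂ν := funext hQ
  refine ⟨?_, ?_⟩
  · change Integrable (fun y => Qint s b Θ (Real.log (y + d))) μ
    rw [hQfun]
    exact hFint.integral_prod_left
  rw [hQfun]
  change ∫ y, ∫ θ, F y θ ∂ν ∂μ ≤ _
  rw [integral_integral_swap hFint]
  have hinner : ∀ θ ∈ Set.Ioc 0 Θ, ∫ y, F y θ ∂μ ≤ (B + d) * (Real.exp 4 * Pfreq X a Θ) := by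
    intro θ hθ
    have h1 := setIntegral_comp_log_add_le (g := fun v => ‖wlogWindow s b θ v‖ ^ 2)
      ((memLp_two_iff_integrable_sq_norm (integrable_wlogWindow s b θ).aestronglyMeasurable).1
        (memLp_two_wlogWindow s b θ)) (fun v => sq_nonneg _) hA hAB hd
    refine h1.trans (mul_le_mul_of_nonneg_left ?_ (by linarith))
    exact integral_norm_sq_wlogWindow_le s b hθ.1.le hθ.2 hΘ
  calc ∫ θ, ∫ y, F y θ ∂μ ∂ν ≤ ∫ θ, (B + d) * (Real.exp 4 * Pfreq X a Θ) ∂ν := by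
        refine integral_mono_of_nonneg ?_ (integrable_const _) ?_
        · exact Eventually.of_forall fun θ => integral_nonneg fun y => sq_nonneg _
        · exact (ae_restrict_iff' measurableSet_Ioc).2 (Eventually.of_forall hinner)
    _ = Θ * (B + d) * (Real.exp 4 * Pfreq X a Θ) := by
        rw [integral_const, smul_eq_mul]
        simp [ν, Measure.real, Real.volume_Ioc, ENNReal.toReal_ofReal hΘ0]
        ring

/-- **The integral over `y ∈ (X, 2X]`** in terms of the frequency-side energy:
`∫_{(X,2X]} ‖h⁻¹ ∑_{y ≤ m ≤ y+h} a_m‖² dy ≤ 130 e⁴ (X³/h²) P(θ_b)` for `0 < h ≤ X`, `X ≥ 1`.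
[cite: MatomakiRadziwillTao2015, Appendix A (Parseval bound)] -/
theorem setIntegral_norm_sq_shortAvg_le (a : ℕ → ℂ) {X h : ℝ} (hX : 1 ≤ X) (hh : 0 < h) (hhX : h ≤ X) :
    ∫ y in Set.Ioc X (2 * X), ‖shortAvg X h a y‖ ^ 2
      ≤ 130 * Real.exp 4 * (X ^ 3 / h ^ 2) * Pfreq X a (thetaB X h) := by
  have hX0 : 0 < X := by linarith
  have hX2 : X ≤ 2 * X := by linarith
  set s := suppS X
  set b := coeffC a
  set Θ := thetaB X h with hΘdef
  have hΘ0 : 0 ≤ Θ := (thetaA_nonneg hX0 hh.le).trans (thetaA_le_thetaB hX0 hh.le)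
  have hΘle : Θ ≤ 2 * (h / X) := thetaB_le hX0 hh.le
  have hhX1 : h / X ≤ 1 := by rw [div_le_one hX0]; exact hhX
  have hΘ2 : Θ ≤ 2 := by linarith
  set μ : Measure ℝ := volume.restrict (Set.Ioc X (2 * X))
  haveI : IsFiniteMeasure μ := ⟨by simp [μ, Real.volume_Ioc]⟩
  set c := 13 * (X / h) ^ 3 with hc
  set P := Real.exp 4 * Pfreq X a Θ with hP
  have hP0 : 0 ≤ P := mul_nonneg (Real.exp_pos 4).le (Pfreq_nonneg X a Θ)
  obtain ⟨i0, b0⟩ := setIntegral_Qint_log_le a (X := X) hΘ0 hΘ2 hX0 hX2 le_rfl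
  obtain ⟨i1, b1⟩ := setIntegral_Qint_log_le a (X := X) hΘ0 hΘ2 hX0 hX2 hh.le
  set R : ℝ → ℝ := fun y => c * (Qint s b Θ (Real.log (y + 0)) + Qint s b Θ (Real.log (y + h))) with hR
  have iR : Integrable R μ := (i0.add i1).const_mul c
  have hae : ∀ᵐ y ∂μ, ‖shortAvg X h a y‖ ^ 2 ≤ R y := by
    have h1 : ∀ᵐ y ∂μ, y ∈ Set.Ioc X (2 * X) := ae_restrict_mem measurableSet_Ioc
    have h2 : ∀ᵐ y ∂μ, ∀ n : ℕ, (n : ℝ) ≠ y := ae_restrict_of_ae ae_not_natCast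
    filter_upwards [h1, h2] with y hy hyN
    have := norm_sq_shortAvg_le_Qint a hX hy.1.le hy.2 hh hhX hyN
    simp only [hR, add_zero]
    exact this
  calc ∫ y in Set.Ioc X (2 * X), ‖shortAvg X h a y‖ ^ 2
      ≤ ∫ y, R y ∂μ := integral_mono_of_nonneg (Eventually.of_forall fun y => sq_nonneg _) iR hae
    _ = c * ((∫ y, Qint s b Θ (Real.log (y + 0)) ∂μ) + ∫ y, Qint s b Θ (Real.log (y + h)) ∂μ) := by
        rw [hR, integral_const_mul, integral_add i0 i1]
    _ ≤ c * (Θ * (2 * X + 0) * P + Θ * (2 * X + h) * P) := by gcongr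
    _ ≤ c * (2 * (h / X) * (5 * X) * P) := by
        refine mul_le_mul_of_nonneg_left ?_ (by positivity)
        have : Θ * (2 * X + 0) * P + Θ * (2 * X + h) * P = Θ * (4 * X + h) * P := by ring
        rw [this]
        refine mul_le_mul_of_nonneg_right ?_ hP0
        exact mul_le_mul hΘle (by linarith) (by linarith) (by positivity)
    _ = 130 * Real.exp 4 * (X ^ 3 / h ^ 2) * Pfreq X a Θ := by
        rw [hc, hP]; field_simp; ring


/-! ### The frequency side: from `ξ` to `t = 2πξ`, folding `t ↦ -t`, and the dyadic `sup` term -/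

open Literature.NumberTheory.Sieve.MatomakiRadziwillL14 (ofReal_cpow_neg_one_add exists_mem_dyadic
  iUnion_dyadic pairwise_disjoint_dyadic)

/-- The Dirichlet polynomial of the statement, `A(t) = ∑_{X ≤ m ≤ 2X} a_m m^{-1-it}`. [folklore] -/
def Apoly (X : ℝ) (a : ℕ → ℂ) (t : ℝ) : ℂ :=
  ∑ m ∈ suppS X, a m * (m : ℂ) ^ (-(1 + (t : ℂ) * Complex.I))

/-- `A(t) = dirichletSumC(t/2π)` with coefficients `b_m = a_m/m`. [folklore] -/
theorem Apoly_eq (X : ℝ) (hX : 1 ≤ X) (a : ℕ → ℂ) (t : ℝ) :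
    Apoly X a t = dirichletSumC (suppS X) (coeffC a) (t / (2 * π)) := by
  unfold Apoly dirichletSumC
  refine Finset.sum_congr rfl fun m hm => ?_
  have hm0 : (0 : ℝ) < m := pos_of_mem_suppS hX hm
  rw [show (m : ℂ) = ((m : ℝ) : ℂ) by simp, ofReal_cpow_neg_one_add _ hm0, coeffC]
  have e : -(↑(t * Real.log m)) * Complex.I = ↑(-2 * π * (t / (2 * π) * Real.log m)) * Complex.I := by
    congr 1
    have : (2 : ℝ) * π ≠ 0 := by positivity
    push_cast
    field_simp
  rw [e]
  push_cast
  field_simp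

/-- `A` is continuous. [folklore] -/
theorem continuous_Apoly (X : ℝ) (hX : 1 ≤ X) (a : ℕ → ℂ) : Continuous (Apoly X a) := by
  have : Apoly X a = fun t => dirichletSumC (suppS X) (coeffC a) (t / (2 * π)) :=
    funext (Apoly_eq X hX a)
  rw [this]
  exact (continuous_dirichletSumC _ _).comp (continuous_id.div_const _)

/-- `‖A(t)‖ ≤ 2`. [folklore] -/
theorem norm_Apoly_le (X : ℝ) (hX : 1 ≤ X) {a : ℕ → ℂ} (ha : ∀ m, ‖a m‖ ≤ 1) (t : ℝ) :
    ‖Apoly X a t‖ ≤ 2 := by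
  rw [Apoly_eq X hX]
  exact (norm_dirichletSumC_le _ _ _).trans (sum_norm_coeffC_le ha hX)

/-- The symmetrised square `B(t) = ‖A(t)‖² + ‖A(-t)‖²` (the two-sided mean values of the statement
are integrals of `B` over `t > 0`). [folklore] -/
def Bsq (X : ℝ) (a : ℕ → ℂ) (t : ℝ) : ℝ := ‖Apoly X a t‖ ^ 2 + ‖Apoly X a (-t)‖ ^ 2

/-- `0 ≤ B`. [folklore] -/
theorem Bsq_nonneg (X : ℝ) (a : ℕ → ℂ) (t : ℝ) : 0 ≤ Bsq X a t := by unfold Bsq; positivity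

/-- `B ≤ 8`. [folklore] -/
theorem Bsq_le (X : ℝ) (hX : 1 ≤ X) {a : ℕ → ℂ} (ha : ∀ m, ‖a m‖ ≤ 1) (t : ℝ) : Bsq X a t ≤ 8 := by
  have h1 := norm_Apoly_le X hX ha t
  have h2 := norm_Apoly_le X hX ha (-t)
  unfold Bsq
  nlinarith [norm_nonneg (Apoly X a t), norm_nonneg (Apoly X a (-t))]

/-- `B` is continuous. [folklore] -/
theorem continuous_Bsq (X : ℝ) (hX : 1 ≤ X) (a : ℕ → ℂ) : Continuous (Bsq X a) := by
  unfold Bsq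
  have hc := continuous_Apoly X hX a
  fun_prop

/-- The `sup` term: `S(U) = sup_{T ≥ U} (U/T) ∫_T^{2T} B(t) dt`, i.e.
`sup_{T ≥ U} (U/T) ∫_{T ≤ |t| ≤ 2T} |A(1+it)|² dt`. [folklore] -/
def Ssup (X : ℝ) (a : ℕ → ℂ) (U : ℝ) : ℝ :=
  ⨆ T : Set.Ici U, U / (T : ℝ) * ∫ t in (T : ℝ)..2 * T, Bsq X a t

/-- The family behind `S` is bounded (by `8U`), so the `iSup` is a genuine supremum. [folklore] -/
theorem bddAbove_Ssup (X : ℝ) (hX : 1 ≤ X) {a : ℕ → ℂ} (ha : ∀ m, ‖a m‖ ≤ 1) {U : ℝ} (hU : 0 < U) :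
    BddAbove (Set.range fun T : Set.Ici U => U / (T : ℝ) * ∫ t in (T : ℝ)..2 * T, Bsq X a t) := by
  refine ⟨U * 8, ?_⟩
  rintro _ ⟨T, rfl⟩
  have hT : 0 < (T : ℝ) := hU.trans_le T.2
  have h1 : ∫ t in (T : ℝ)..2 * T, Bsq X a t ≤ 8 * |2 * (T : ℝ) - T| := by
    have := intervalIntegral.norm_integral_le_of_norm_le_const (a := (T : ℝ)) (b := 2 * T) (C := 8)
      (f := fun t => Bsq X a t) (fun t _ => by
        rw [Real.norm_eq_abs, abs_of_nonneg (Bsq_nonneg X a t)]; exact Bsq_le X hX ha t)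
    exact (le_abs_self _).trans (by rw [← Real.norm_eq_abs]; exact this)
  rw [show 2 * (T : ℝ) - T = T by ring, abs_of_pos hT] at h1
  calc U / (T : ℝ) * ∫ t in (T : ℝ)..2 * T, Bsq X a t ≤ U / T * (8 * T) :=
        mul_le_mul_of_nonneg_left h1 (by positivity)
    _ = U * 8 := by field_simp

/-- `0 ≤ S`. [folklore] -/
theorem Ssup_nonneg (X : ℝ) (a : ℕ → ℂ) {U : ℝ} (hU : 0 < U) : 0 ≤ Ssup X a U := by
  refine Real.iSup_nonneg fun T => ?_
  have hT : 0 < (T : ℝ) := hU.trans_le T.2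
  exact mul_nonneg (by positivity) (intervalIntegral.integral_nonneg (by linarith) fun t _ => Bsq_nonneg X a t)

/-- Each dyadic block is controlled by `S`: `∫_T^{2T} B ≤ (T/U) S` for `T ≥ U`. [folklore] -/
theorem integral_le_Ssup (X : ℝ) (hX : 1 ≤ X) {a : ℕ → ℂ} (ha : ∀ m, ‖a m‖ ≤ 1) {U T : ℝ}
    (hU : 0 < U) (hT : U ≤ T) :
    ∫ t in T..2 * T, Bsq X a t ≤ T / U * Ssup X a U := by
  have hT0 : 0 < T := hU.trans_le hT
  have h := le_ciSup (bddAbove_Ssup X hX ha hU) ⟨T, hT⟩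
  change U / T * ∫ t in T..2 * T, Bsq X a t ≤ Ssup X a U at h
  rw [div_mul_eq_mul_div, div_le_iff₀ hT0] at h
  rw [div_mul_eq_mul_div, le_div_iff₀ hU]
  linarith

/-- `t ↦ B(t)/t²` is integrable on `(U, ∞)` for `U ≥ 1`. [folklore] -/
theorem integrableOn_Bsq_div (X : ℝ) (hX : 1 ≤ X) {a : ℕ → ℂ} (ha : ∀ m, ‖a m‖ ≤ 1)
    {U : ℝ} (hU : 1 ≤ U) : IntegrableOn (fun t => Bsq X a t / t ^ 2) (Set.Ioi U) := by
  have hmeas : AEStronglyMeasurable (fun t => Bsq X a t / t ^ 2) (volume.restrict (Set.Ioi U)) :=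
    (Measurable.div (continuous_Bsq X hX a).measurable (measurable_id.pow_const 2)).aestronglyMeasurable
  refine ((integrable_inv_one_add_sq.const_mul 16).integrableOn).mono' hmeas ?_
  refine (ae_restrict_iff' measurableSet_Ioi).2 (Eventually.of_forall fun t ht => ?_)
  have ht1 : 1 ≤ t := hU.trans ht.le
  rw [Real.norm_eq_abs, abs_of_nonneg (div_nonneg (Bsq_nonneg X a t) (sq_nonneg _)), ← div_eq_mul_inv]
  have hA := Bsq_le X hX ha t
  calc Bsq X a t / t ^ 2 ≤ 8 / t ^ 2 := div_le_div_of_nonneg_right hA (by positivity)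
    _ ≤ 16 / (1 + t ^ 2) := by
        rw [div_le_div_iff₀ (by positivity) (by positivity)]
        nlinarith

/-- **The dyadic bound**: `∫_U^∞ B(t)/t² dt ≤ 2 S / U²` (`U ≥ 1`).
[cite: MatomakiRadziwillAnnals2016, §7, proof of Lemma 14 (last display)] -/
theorem integral_Ioi_le_Ssup (X : ℝ) (hX : 1 ≤ X) {a : ℕ → ℂ} (ha : ∀ m, ‖a m‖ ≤ 1) {U : ℝ}
    (hU : 1 ≤ U) :
    ∫ t in Set.Ioi U, Bsq X a t / t ^ 2 ≤ 2 * Ssup X a U / U ^ 2 := by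
  have hU0 : 0 < U := by linarith
  set f : ℝ → ℝ := fun t => Bsq X a t / t ^ 2
  set blk : ℕ → Set ℝ := fun k => Set.Ioc (U * 2 ^ k) (U * 2 ^ (k + 1))
  have hint : IntegrableOn f (⋃ k, blk k) := by
    rw [iUnion_dyadic hU0]; exact integrableOn_Bsq_div X hX ha hU
  have hsum := hasSum_integral_iUnion (f := f) (μ := volume) (fun k => measurableSet_Ioc)
    (pairwise_disjoint_dyadic hU0) hint
  rw [iUnion_dyadic hU0] at hsum
  have hblk : ∀ k : ℕ, ∫ t in blk k, f t ≤ Ssup X a U / U ^ 2 * (1 / 2) ^ k := by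
    intro k
    set T := U * 2 ^ k with hT
    have hT0 : 0 < T := by positivity
    have hUT : U ≤ T := le_mul_of_one_le_right hU0.le (one_le_pow₀ (by norm_num))
    have hcont : Continuous fun t => Bsq X a t := continuous_Bsq X hX a
    have h2T : U * 2 ^ (k + 1) = 2 * T := by rw [hT, pow_succ]; ring
    have step1 : ∫ t in blk k, f t ≤ ∫ t in blk k, T⁻¹ ^ 2 * Bsq X a t := by
      refine setIntegral_mono_on (hint.mono_set (Set.subset_iUnion blk k)) ?_ measurableSet_Ioc ?_
      · exact (hcont.const_mul _ |>.integrableOn_Icc).mono_set Set.Ioc_subset_Icc_self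
      · intro t ht
        have ht0 : T < t := ht.1
        simp only [f]
        rw [div_eq_mul_inv, mul_comm]
        refine mul_le_mul_of_nonneg_right ?_ (Bsq_nonneg X a t)
        rw [← inv_pow]
        have ht0' : 0 < t := hT0.trans ht0
        exact pow_le_pow_left₀ (inv_pos.2 ht0').le ((inv_le_inv₀ ht0' hT0).2 ht0.le) 2
    have step2 : ∫ t in blk k, T⁻¹ ^ 2 * Bsq X a t
        = T⁻¹ ^ 2 * ∫ t in T..2 * T, Bsq X a t := by
      rw [integral_const_mul, intervalIntegral.integral_of_le (by linarith)]
      simp only [blk, h2T, hT]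
    have step3 := integral_le_Ssup X hX ha hU0 hUT
    calc ∫ t in blk k, f t ≤ T⁻¹ ^ 2 * ∫ t in T..2 * T, Bsq X a t := step1.trans step2.le
      _ ≤ T⁻¹ ^ 2 * (T / U * Ssup X a U) := mul_le_mul_of_nonneg_left step3 (by positivity)
      _ = Ssup X a U / U ^ 2 * (1 / 2) ^ k := by
          rw [hT, one_div_pow]; field_simp
  have hgeo : HasSum (fun k : ℕ => Ssup X a U / U ^ 2 * (1 / 2 : ℝ) ^ k) (Ssup X a U / U ^ 2 * 2) :=
    hasSum_geometric_two.mul_left _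
  have := hasSum_le hblk hsum hgeo
  calc ∫ t in Set.Ioi U, f t ≤ Ssup X a U / U ^ 2 * 2 := this
    _ = 2 * Ssup X a U / U ^ 2 := by ring

/-- The substituted frequency integrand `ψ(t) = min(Θ², 1/(t/2π)²) ‖A(t)‖²`. [folklore] -/
def psiFreq (X : ℝ) (a : ℕ → ℂ) (Θ t : ℝ) : ℝ :=
  min (Θ ^ 2) (1 / (t / (2 * π)) ^ 2) * ‖Apoly X a t‖ ^ 2

/-- `ψ` is integrable on `ℝ`. [folklore] -/
theorem integrable_psiFreq (X : ℝ) (hX : 1 ≤ X) (a : ℕ → ℂ) (Θ : ℝ) : Integrable (psiFreq X a Θ) := by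
  have h := (integrable_min_mul_norm_sq (suppS X) (coeffC a) Θ).comp_div (R := 2 * π) (by positivity)
  refine h.congr (Eventually.of_forall fun t => ?_)
  simp only [psiFreq, Apoly_eq X hX]

/-- `0 ≤ ψ`. [folklore] -/
theorem psiFreq_nonneg (X : ℝ) (a : ℕ → ℂ) (Θ t : ℝ) : 0 ≤ psiFreq X a Θ t :=
  mul_nonneg (le_min (sq_nonneg _) (by positivity)) (sq_nonneg _)

/-- `ψ(t) ≤ Θ² ‖A(t)‖²`. [folklore] -/
theorem psiFreq_le_sq (X : ℝ) (a : ℕ → ℂ) (Θ t : ℝ) : psiFreq X a Θ t ≤ Θ ^ 2 * ‖Apoly X a t‖ ^ 2 :=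
  mul_le_mul_of_nonneg_right (min_le_left _ _) (sq_nonneg _)

/-- `ψ(t) ≤ 4π² ‖A(t)‖² / t²` for `t ≠ 0`. [folklore] -/
theorem psiFreq_le_div (X : ℝ) (a : ℕ → ℂ) (Θ : ℝ) {t : ℝ} (ht : t ≠ 0) :
    psiFreq X a Θ t ≤ 4 * π ^ 2 * (‖Apoly X a t‖ ^ 2 / t ^ 2) := by
  unfold psiFreq
  have h1 : 1 / (t / (2 * π)) ^ 2 = 4 * π ^ 2 / t ^ 2 := by
    field_simp
    ring
  calc min (Θ ^ 2) (1 / (t / (2 * π)) ^ 2) * ‖Apoly X a t‖ ^ 2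
      ≤ 1 / (t / (2 * π)) ^ 2 * ‖Apoly X a t‖ ^ 2 := mul_le_mul_of_nonneg_right (min_le_right _ _) (sq_nonneg _)
    _ = 4 * π ^ 2 * (‖Apoly X a t‖ ^ 2 / t ^ 2) := by rw [h1]; ring

/-- **Substitution `ξ = t/2π`**: `P(Θ) = (2π)⁻¹ ∫ ψ(t) dt`. [folklore] -/
theorem Pfreq_eq (X : ℝ) (hX : 1 ≤ X) (a : ℕ → ℂ) (Θ : ℝ) :
    Pfreq X a Θ = (2 * π)⁻¹ * ∫ t, psiFreq X a Θ t := by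
  have h2π : (0 : ℝ) < 2 * π := by positivity
  have hsub := MeasureTheory.Measure.integral_comp_div
    (fun ξ : ℝ => min (Θ ^ 2) (1 / ξ ^ 2) * ‖dirichletSumC (suppS X) (coeffC a) ξ‖ ^ 2) (2 * π)
  rw [abs_of_pos h2π, smul_eq_mul] at hsub
  have hψ : (fun t => psiFreq X a Θ t)
      = fun t : ℝ => min (Θ ^ 2) (1 / (t / (2 * π)) ^ 2) * ‖dirichletSumC (suppS X) (coeffC a) (t / (2 * π))‖ ^ 2 := by
    funext t; simp only [psiFreq, Apoly_eq X hX]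
  rw [Pfreq, hψ, hsub]
  field_simp

/-- **Folding `t ↦ -t`**: `∫_ℝ ψ = ∫_{t > 0} (ψ(t) + ψ(-t))`. [folklore] -/
theorem integral_psiFreq_eq_Ioi (X : ℝ) (hX : 1 ≤ X) (a : ℕ → ℂ) (Θ : ℝ) :
    ∫ t, psiFreq X a Θ t = ∫ t in Set.Ioi 0, (psiFreq X a Θ t + psiFreq X a Θ (-t)) := by
  have hi := integrable_psiFreq X hX a Θ
  rw [← intervalIntegral.integral_Iic_add_Ioi (b := 0) hi.integrableOn hi.integrableOn]
  have hneg : ∫ t in Set.Iic (0 : ℝ), psiFreq X a Θ t = ∫ t in Set.Ioi (0 : ℝ), psiFreq X a Θ (-t) := by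
    rw [integral_comp_neg_Ioi, neg_zero]
  rw [hneg, ← integral_add _ hi.integrableOn]
  · exact integral_congr_ae (Eventually.of_forall fun t => by ring)
  · have := (hi.comp_neg).integrableOn (s := Set.Ioi (0 : ℝ))
    exact this

/-- `ψ(t) + ψ(-t) ≤ Θ² B(t)`. [folklore] -/
theorem psiFreq_add_le_sq (X : ℝ) (a : ℕ → ℂ) (Θ t : ℝ) :
    psiFreq X a Θ t + psiFreq X a Θ (-t) ≤ Θ ^ 2 * Bsq X a t := by
  have h1 := psiFreq_le_sq X a Θ t
  have h2 := psiFreq_le_sq X a Θ (-t)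
  unfold Bsq; linarith

/-- `ψ(t) + ψ(-t) ≤ 4π² B(t)/t²` for `t ≠ 0`. [folklore] -/
theorem psiFreq_add_le_div (X : ℝ) (a : ℕ → ℂ) (Θ : ℝ) {t : ℝ} (ht : t ≠ 0) :
    psiFreq X a Θ t + psiFreq X a Θ (-t) ≤ 4 * π ^ 2 * (Bsq X a t / t ^ 2) := by
  have h1 := psiFreq_le_div X a Θ ht
  have h2 := psiFreq_le_div X a Θ (neg_ne_zero.2 ht)
  rw [neg_sq] at h2
  unfold Bsq
  rw [add_div, mul_add]
  exact add_le_add h1 h2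

/-- **`P ≤ 4π U⁻² (I + S)`** with `I = ∫_0^U B`, `S = S(U)`, for `U ≥ 1` and `Θ² ≤ 4/U²`:
the range `|t| ≤ U` gives `I`, the range `|t| > U` is cut dyadically against `S`.
[cite: MatomakiRadziwillAnnals2016, §7, proof of Lemma 14] -/
theorem Pfreq_le (X : ℝ) (hX : 1 ≤ X) {a : ℕ → ℂ} (ha : ∀ m, ‖a m‖ ≤ 1) {Θ U : ℝ}
    (hU : 1 ≤ U) (hΘU : Θ ^ 2 ≤ 4 / U ^ 2) :
    Pfreq X a Θ ≤ 4 * π / U ^ 2 * ((∫ t in (0 : ℝ)..U, Bsq X a t) + Ssup X a U) := by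
  have hU0 : 0 < U := by linarith
  have hπ : 0 < π := Real.pi_pos
  set I := ∫ t in (0 : ℝ)..U, Bsq X a t with hI
  set S := Ssup X a U with hS
  have hcontB := continuous_Bsq X hX a
  have hI0 : 0 ≤ I := intervalIntegral.integral_nonneg hU0.le fun t _ => Bsq_nonneg X a t
  have hS0 : 0 ≤ S := Ssup_nonneg X a hU0
  have hi := integrable_psiFreq X hX a Θ
  -- integrability of the folded integrand and of the two majorants
  have hfold : Integrable (fun t => psiFreq X a Θ t + psiFreq X a Θ (-t)) := hi.add hi.comp_neg
  have hmaj1 : IntegrableOn (fun t => Θ ^ 2 * Bsq X a t) (Set.Ioc 0 U) :=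
    ((hcontB.const_mul _).integrableOn_Icc).mono_set Set.Ioc_subset_Icc_self
  have hJ := integrableOn_Bsq_div X hX ha hU
  have hmaj2 : IntegrableOn (fun t => 4 * π ^ 2 * (Bsq X a t / t ^ 2)) (Set.Ioi U) := hJ.const_mul _
  -- split `(0, ∞) = (0, U] ∪ (U, ∞)`
  have hsplit : Set.Ioi (0 : ℝ) = Set.Ioc 0 U ∪ Set.Ioi U := (Set.Ioc_union_Ioi_eq_Ioi hU0.le).symm
  have hdisj : Disjoint (Set.Ioc (0 : ℝ) U) (Set.Ioi U) := Set.Ioc_disjoint_Ioi le_rfl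
  have hmain : ∫ t in Set.Ioi 0, (psiFreq X a Θ t + psiFreq X a Θ (-t))
      ≤ Θ ^ 2 * I + 4 * π ^ 2 * (2 * S / U ^ 2) := by
    rw [hsplit, setIntegral_union hdisj measurableSet_Ioi hfold.integrableOn hfold.integrableOn]
    refine add_le_add ?_ ?_
    · calc ∫ t in Set.Ioc 0 U, (psiFreq X a Θ t + psiFreq X a Θ (-t))
          ≤ ∫ t in Set.Ioc 0 U, Θ ^ 2 * Bsq X a t :=
            setIntegral_mono_on hfold.integrableOn hmaj1 measurableSet_Ioc fun t _ => psiFreq_add_le_sq X a Θ t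
        _ = Θ ^ 2 * I := by
            rw [integral_const_mul, hI, intervalIntegral.integral_of_le hU0.le]
    · calc ∫ t in Set.Ioi U, (psiFreq X a Θ t + psiFreq X a Θ (-t))
          ≤ ∫ t in Set.Ioi U, 4 * π ^ 2 * (Bsq X a t / t ^ 2) :=
            setIntegral_mono_on hfold.integrableOn hmaj2 measurableSet_Ioi fun t ht =>
              psiFreq_add_le_div X a Θ (by have : (0:ℝ) < t := hU0.trans ht; exact this.ne')
        _ = 4 * π ^ 2 * ∫ t in Set.Ioi U, Bsq X a t / t ^ 2 := integral_const_mul _ _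
        _ ≤ 4 * π ^ 2 * (2 * S / U ^ 2) :=
            mul_le_mul_of_nonneg_left (integral_Ioi_le_Ssup X hX ha hU) (by positivity)
  rw [Pfreq_eq X hX, integral_psiFreq_eq_Ioi X hX]
  have h2π : (0 : ℝ) < (2 * π)⁻¹ := by positivity
  calc (2 * π)⁻¹ * ∫ t in Set.Ioi 0, (psiFreq X a Θ t + psiFreq X a Θ (-t))
      ≤ (2 * π)⁻¹ * (Θ ^ 2 * I + 4 * π ^ 2 * (2 * S / U ^ 2)) := mul_le_mul_of_nonneg_left hmain h2π.le
    _ ≤ (2 * π)⁻¹ * (4 / U ^ 2 * I + 4 * π ^ 2 * (2 * S / U ^ 2)) := by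
        gcongr
    _ = 4 * π / U ^ 2 * ((2 * π ^ 2)⁻¹ * I + S) := by field_simp
    _ ≤ 4 * π / U ^ 2 * (I + S) := by
        refine mul_le_mul_of_nonneg_left (add_le_add ?_ le_rfl) (by positivity)
        have hc : (2 * π ^ 2)⁻¹ ≤ (1 : ℝ) := by
          refine inv_le_one_of_one_le₀ ?_
          nlinarith [Real.pi_gt_three]
        calc (2 * π ^ 2)⁻¹ * I ≤ 1 * I := mul_le_mul_of_nonneg_right hc hI0
          _ = I := one_mul I

/-! ### Assembly -/

/-- **The Parseval bound for short sums with complex coefficients** (the first step of the proof of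
Matomäki–Radziwiłł–Tao 2015, Theorem A.2: "a Parseval bound … This follows exactly in the same way as
[MR 2016, Lemma 14] but there is no need to split the integral into two parts", in the two-sided form
that complex coefficients require).  There is an absolute constant `C` (`= 520 π e⁴`) such that for
`X ≥ 1`, `1 ≤ h ≤ X` and complex `|a_m| ≤ 1`,
`(1/X) ∫_X^{2X} |h⁻¹ ∑_{x ≤ m ≤ x+h, X ≤ m ≤ 2X} a_m|² dx
   ≤ C (∫_0^{X/h} (|A(1+it)|² + |A(1-it)|²) dt + sup_{T ≥ X/h} (X/h)/T ∫_T^{2T} (|A(1+it)|² + |A(1-it)|²) dt)`,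
`A(s) = ∑_{X ≤ m ≤ 2X} a_m m^{-s}` (`Apoly`, `Bsq`, `Ssup`).  Proof: the exact window identity
`∑_{y<m≤y+h} a_m = y G_θ(log y) - (y+h) G_{θ-c(y)}(log(y+h))` for every multiplicative width
`θ ∈ [θ_a, θ_b]` (`sum_window_eq`), averaging over `θ`, Tonelli and `y = e^v`
(`setIntegral_norm_sq_shortAvg_le`), Plancherel for the weighted window
(`integral_norm_sq_wlogWindow_le`) and the frequency-side bookkeeping (`Pfreq_le`).
[cite: MatomakiRadziwillTao2015, Appendix A (Parseval bound)] -/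
theorem meanSquare_shortAvg_le :
    ∃ C : ℝ, 0 < C ∧ ∀ (X h : ℝ) (a : ℕ → ℂ), 1 ≤ X → 1 ≤ h → h ≤ X → (∀ m, ‖a m‖ ≤ 1) →
      1 / X * ∫ x in X..2 * X,
          ‖(h : ℂ)⁻¹ * ∑ m ∈ (Finset.Icc ⌈x⌉₊ ⌊x + h⌋₊).filter (fun m : ℕ => X ≤ m ∧ (m : ℝ) ≤ 2 * X), a m‖ ^ 2
        ≤ C * ((∫ t in (0 : ℝ)..X / h, Bsq X a t) + Ssup X a (X / h)) := by
  refine ⟨520 * π * Real.exp 4, by positivity, ?_⟩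
  intro X h a hX hh hhX ha
  have hX0 : 0 < X := by linarith
  have hh0 : 0 < h := by linarith
  set U := X / h with hU
  have hU1 : 1 ≤ U := by rw [hU, le_div_iff₀ hh0]; linarith
  have hU0 : 0 < U := by linarith
  have hΘ : thetaB X h ^ 2 ≤ 4 / U ^ 2 := by
    have h0 : 0 ≤ thetaB X h := (thetaA_nonneg hX0 hh0.le).trans (thetaA_le_thetaB hX0 hh0.le)
    have h1 : thetaB X h ≤ 2 * (h / X) := thetaB_le hX0 hh0.le
    have h2 : 2 * (h / X) = 2 / U := by rw [hU]; field_simp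
    rw [h2] at h1
    calc thetaB X h ^ 2 ≤ (2 / U) ^ 2 := pow_le_pow_left₀ h0 h1 2
      _ = 4 / U ^ 2 := by rw [div_pow]; norm_num
  set I := ∫ t in (0 : ℝ)..U, Bsq X a t
  set S := Ssup X a U
  have hI0 : 0 ≤ I := intervalIntegral.integral_nonneg hU0.le fun t _ => Bsq_nonneg X a t
  have hS0 : 0 ≤ S := Ssup_nonneg X a hU0
  have h1 := setIntegral_norm_sq_shortAvg_le a hX hh0 hhX
  have h2 := Pfreq_le X hX ha hU1 hΘ
  rw [intervalIntegral.integral_of_le (by linarith : X ≤ 2 * X)]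
  change 1 / X * ∫ y in Set.Ioc X (2 * X), ‖shortAvg X h a y‖ ^ 2 ≤ 520 * π * Real.exp 4 * (I + S)
  have h3 : ∫ y in Set.Ioc X (2 * X), ‖shortAvg X h a y‖ ^ 2 ≤ 520 * π * Real.exp 4 * X * (I + S) := by
    calc ∫ y in Set.Ioc X (2 * X), ‖shortAvg X h a y‖ ^ 2
        ≤ 130 * Real.exp 4 * (X ^ 3 / h ^ 2) * Pfreq X a (thetaB X h) := h1
      _ ≤ 130 * Real.exp 4 * (X ^ 3 / h ^ 2) * (4 * π / U ^ 2 * (I + S)) :=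
          mul_le_mul_of_nonneg_left h2 (by positivity)
      _ = 520 * π * Real.exp 4 * X * (I + S) := by rw [hU]; field_simp; ring
  rw [one_div, inv_mul_le_iff₀ hX0]
  linarith

end MRT2015.Parseval

end Literature.NumberTheory.LFunctions
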